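import Summits.NavierStokesRegularity.NavierStokesRegularity.Theorems.ExtremiserTransienceTwoThirdsPieceIntegrals
import HarnessLib

/-!
# Route `ExtremiserTransience`, crux `NearExtremalTransiencePerFlow` (stmt-NavierStokesRegularity-26567),
# LINE g10-1 «two_thirds» (ns-idea-10), stub S1a′ — BRICK 2, lemma P3d′: `Z`, `W`, `J` OF A PIECE — MEASURABLE-SET VERSION

`--supports stmt-NavierStokesRegularity-26567` (helper; prover seat ns-net-p2 g13).  Verbatim `…TwoThirdsPieceIntegrals` (p732161) with the cell
`B(c,R) ⊆ B(c,R+ℓ)` replaced by measurable sets `B ⊆ B⁺` (layer `L = B⁺ ∖ B`), so that the REMAINDER piece of a packing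
(`B⁺ = (⋃ cells)ᶜ`, `B = (⋃ enlarged cells)ᶜ`, `L = ⋃ layers`) is covered by the same statements:
`Zen_piece_le_set`, `Wpa_piece_le_set`, `Jst_piece_ge_set`.  HONEST FRAMING: measure bookkeeping; nothing about Navier–Stokes is proved;
no summit is proved by a line. [folklore]
-/

noncomputable section

open scoped Topology InnerProductSpace RealInnerProductSpace ENNReal NNReal ContDiff
open MeasureTheory Filter Set Metric
open Literature.Analysis.FluidPDE
open Summit.NavierStokesRegularity.NavierStokesRegularity.Theorems.DepletionLadder.KStar.HalfSpace
open Summit.NavierStokesRegularity.NavierStokesRegularity.Theorems.DepletionLadder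
open Summit.NavierStokesRegularity.NavierStokesRegularity.Theorems.NearExtremalTransiencePerFlow.LocalMaximiser

namespace Summit.NavierStokesRegularity.NavierStokesRegularity.Theorems.NearExtremalTransiencePerFlow.TwoThirds

-- the summit's namespace repeats the problem name by convention (D-0017)
set_option linter.dupNamespace false

section PieceSet

variable {w φ : E3 → E3} {χ : E3 → ℝ} {B Bp : Set E3} {A₁ m₃ j₁ j₂ : ℝ}

/-- `χ²f ≤ 1_{B⁺} f` for a weight vanishing off `B⁺`. [folklore] -/
theorem sq_weight_le_indicator_set (hχ01 : ∀ x, 0 ≤ χ x ∧ χ x ≤ 1) (hχout : ∀ x, x ∉ Bp → χ x = 0)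
    {f : E3 → ℝ} (hf : ∀ x, 0 ≤ f x) (x : E3) :
    χ x ^ 2 * f x ≤ (Bp).indicator f x := by
  by_cases hx : x ∈ Bp
  · rw [indicator_of_mem hx]
    have h1 : χ x ^ 2 ≤ 1 := by nlinarith only [(hχ01 x).1, (hχ01 x).2]
    nlinarith only [h1, hf x, sq_nonneg (χ x)]
  · rw [indicator_of_notMem hx, hχout x hx]
    simp

/-- **`Z(φ) ≤ Z_B + 2Z_L + 2j₁`** (set version). [folklore] -/
theorem Zen_piece_le_set (hw2 : ContDiff ℝ 2 w) (h1 : ∫⁻ x, ‖iteratedFDeriv ℝ 1 w x‖ₑ ^ 2 < ⊤)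
    (hφ1 : ContDiff ℝ 1 φ) (hφc : HasCompactSupport φ) (hBm : MeasurableSet B) (hBpm' : MeasurableSet Bp) (hsubB : B ⊆ Bp)
    (hχ01 : ∀ x, 0 ≤ χ x ∧ χ x ≤ 1) (hχout : ∀ x, x ∉ Bp → χ x = 0)
    (he1 : ∀ x, x ∉ Bp \ B → curl φ x - χ x • curl w x = 0)
    (hi1 : Integrable fun x => ‖curl φ x - χ x • curl w x‖ ^ 2) (hj₁ : ∫ x, ‖curl φ x - χ x • curl w x‖ ^ 2 ≤ j₁) :
    Zen φ ≤ (∫ x in B, zd w x) + (2 * ((∫ x in Bp, zd w x) - (∫ x in B, zd w x)) + 2 * j₁) := by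
  have izd : Integrable (zd w) := (integrable_norm_curl_sq hw2 h1).1
  set L : Set E3 := Bp \ B with hL
  have hBpm : MeasurableSet Bp := hBpm'
  have hLm : MeasurableSet L := hBpm'.diff hBm
  -- pointwise majorant
  have hpt : ∀ x, ‖curl φ x‖ ^ 2 ≤ Bp.indicator (zd w) x + L.indicator (zd w) x + 2 * ‖curl φ x - χ x • curl w x‖ ^ 2 := by
    intro x
    have hzd0 : ∀ y, 0 ≤ zd w y := fun y => sq_nonneg _
    have hi2 : 0 ≤ L.indicator (zd w) x := indicator_nonneg (fun y _ => hzd0 y) x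
    by_cases hx : x ∈ L
    · have hxB : x ∈ Bp := hx.1
      rw [indicator_of_mem hxB, indicator_of_mem hx]
      have hdec : curl φ x = χ x • curl w x + (curl φ x - χ x • curl w x) := by abel
      have hn : ‖curl φ x‖ ≤ ‖χ x • curl w x‖ + ‖curl φ x - χ x • curl w x‖ := by
        rw [hdec]; exact (norm_add_le _ _).trans (by rw [← hdec])
      have hχn : ‖χ x • curl w x‖ ≤ ‖curl w x‖ := by
        rw [norm_smul, Real.norm_eq_abs, abs_of_nonneg (hχ01 x).1]
        exact mul_le_of_le_one_left (norm_nonneg _) (hχ01 x).2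
      have hzd : zd w x = ‖curl w x‖ ^ 2 := rfl
      rw [hzd]
      nlinarith only [hn, hχn, norm_nonneg (curl φ x), norm_nonneg (χ x • curl w x), norm_nonneg (curl φ x - χ x • curl w x),
        norm_nonneg (curl w x), sq_nonneg (‖χ x • curl w x‖ - ‖curl φ x - χ x • curl w x‖)]
    · have h0 : curl φ x - χ x • curl w x = 0 := he1 x hx
      have hcurl : curl φ x = χ x • curl w x := sub_eq_zero.1 h0
      rw [h0, norm_zero, hcurl, norm_smul, Real.norm_eq_abs, mul_pow, sq_abs]
      have := sq_weight_le_indicator_set hχ01 hχout (f := zd w) hzd0 x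
      have hzd : zd w x = ‖curl w x‖ ^ 2 := rfl
      rw [hzd] at this
      linarith only [this, hi2]
  -- integrate
  have hci : Continuous (fun x => ‖curl φ x‖ ^ 2) := (continuous_curl hφ1).norm.pow 2
  have hint : Integrable (fun x => ‖curl φ x‖ ^ 2) := by
    refine hci.integrable_of_hasCompactSupport (HasCompactSupport.intro (hasCompactSupport_curl hφc) fun x hx => ?_)
    rw [image_eq_zero_of_notMem_tsupport hx, norm_zero, zero_pow two_ne_zero]
  have hiB : Integrable (Bp.indicator (zd w)) := izd.indicator hBpm
  have hiL : Integrable (L.indicator (zd w)) := izd.indicator hLm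
  have hrhs : Integrable (fun x => Bp.indicator (zd w) x + L.indicator (zd w) x + 2 * ‖curl φ x - χ x • curl w x‖ ^ 2) :=
    (hiB.add hiL).add (hi1.const_mul 2)
  have hmono := integral_mono hint hrhs hpt
  have hsplit : ∫ x, (Bp.indicator (zd w) x + L.indicator (zd w) x + 2 * ‖curl φ x - χ x • curl w x‖ ^ 2) =
      (∫ x, Bp.indicator (zd w) x) + (∫ x, L.indicator (zd w) x) + 2 * ∫ x, ‖curl φ x - χ x • curl w x‖ ^ 2 := by
    rw [integral_add (f := fun x => Bp.indicator (zd w) x + L.indicator (zd w) x) (g := fun x => 2 * ‖curl φ x - χ x • curl w x‖ ^ 2)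
      (hiB.add hiL) (hi1.const_mul 2), integral_add hiB hiL, integral_const_mul]
  have hB' : ∫ x, Bp.indicator (zd w) x = (∫ x in Bp, zd w x) := by rw [integral_indicator hBpm]
  have hL' : ∫ x, L.indicator (zd w) x = (∫ x in Bp, zd w x) - (∫ x in B, zd w x) := by
    rw [integral_indicator hLm, hL, setIntegral_sdiff hBm izd.integrableOn hsubB]
  unfold Zen
  linarith only [hmono, hsplit, hB', hL', hj₁]

/-- **`W(φ) ≤ W_B + 2W_L + 6j₂`** (set version). [folklore] -/
theorem Wpa_piece_le_set (hw3 : ContDiff ℝ 3 w) (h2 : ∫⁻ x, ‖iteratedFDeriv ℝ 2 w x‖ₑ ^ 2 < ⊤)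
    (hφ2 : ContDiff ℝ 2 φ) (hφc : HasCompactSupport φ) (hBm : MeasurableSet B) (hBpm' : MeasurableSet Bp) (hsubB : B ⊆ Bp)
    (hχ01 : ∀ x, 0 ≤ χ x ∧ χ x ≤ 1) (hχout : ∀ x, x ∉ Bp → χ x = 0)
    (he2 : ∀ x, x ∉ Bp \ B → fderiv ℝ (curl φ) x - χ x • fderiv ℝ (curl w) x = 0)
    (hi2 : Integrable fun x => ‖fderiv ℝ (curl φ) x - χ x • fderiv ℝ (curl w) x‖ ^ 2)
    (hj₂ : ∫ x, ‖fderiv ℝ (curl φ) x - χ x • fderiv ℝ (curl w) x‖ ^ 2 ≤ j₂) :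
    Wpa φ ≤ (∫ x in B, wd w x) + (2 * ((∫ x in Bp, wd w x) - (∫ x in B, wd w x)) + 6 * j₂) := by
  have iwd : Integrable (wd w) := (integrable_frobeniusNormSq_fderiv_curl hw3 h2).1
  set L : Set E3 := Bp \ B with hL
  have hBpm : MeasurableSet Bp := hBpm'
  have hLm : MeasurableSet L := hBpm'.diff hBm
  have hwd0 : ∀ y, 0 ≤ wd w y := fun y => frobeniusNormSq_nonneg _
  -- pointwise majorant
  have hpt : ∀ x, frobeniusNormSq (fderiv ℝ (curl φ) x) ≤
      Bp.indicator (wd w) x + L.indicator (wd w) x + 6 * ‖fderiv ℝ (curl φ) x - χ x • fderiv ℝ (curl w) x‖ ^ 2 := by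
    intro x
    have hi2' : 0 ≤ L.indicator (wd w) x := indicator_nonneg (fun y _ => hwd0 y) x
    have hwd : wd w x = frobeniusNormSq (fderiv ℝ (curl w) x) := rfl
    by_cases hx : x ∈ L
    · have hxB : x ∈ Bp := hx.1
      rw [indicator_of_mem hxB, indicator_of_mem hx]
      have hdec : fderiv ℝ (curl φ) x = χ x • fderiv ℝ (curl w) x + (fderiv ℝ (curl φ) x - χ x • fderiv ℝ (curl w) x) := by abel
      have h1 := frobeniusNormSq_add_le_two (χ x • fderiv ℝ (curl w) x) (fderiv ℝ (curl φ) x - χ x • fderiv ℝ (curl w) x)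
      rw [← hdec, frobeniusNormSq_real_smul] at h1
      have h3 := frobeniusNormSq_le_three_mul_sq (fderiv ℝ (curl φ) x - χ x • fderiv ℝ (curl w) x)
      have hχ2 : χ x ^ 2 ≤ 1 := by nlinarith only [(hχ01 x).1, (hχ01 x).2]
      have h4 : χ x ^ 2 * frobeniusNormSq (fderiv ℝ (curl w) x) ≤ frobeniusNormSq (fderiv ℝ (curl w) x) :=
        mul_le_of_le_one_left (frobeniusNormSq_nonneg _) hχ2
      rw [hwd]
      linarith only [h1, h3, h4]
    · have h0 : fderiv ℝ (curl φ) x - χ x • fderiv ℝ (curl w) x = 0 := he2 x hx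
      have heq : fderiv ℝ (curl φ) x = χ x • fderiv ℝ (curl w) x := sub_eq_zero.1 h0
      rw [h0, norm_zero, heq, frobeniusNormSq_real_smul]
      have := sq_weight_le_indicator_set hχ01 hχout (f := wd w) hwd0 x
      rw [hwd] at this
      linarith only [this, hi2']
  -- integrate
  have hc : Continuous fun x => frobeniusNormSq (fderiv ℝ (curl φ) x) :=
    continuous_frobeniusNormSq_fderiv (contDiff_curl (n := 1) (by exact_mod_cast hφ2)) one_ne_zero
  have hsupp : HasCompactSupport fun x => frobeniusNormSq (fderiv ℝ (curl φ) x) := by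
    refine HasCompactSupport.intro ((hasCompactSupport_curl hφc).fderiv (𝕜 := ℝ)) fun x hx => ?_
    rw [image_eq_zero_of_notMem_tsupport hx, frobeniusNormSq_zero]
  have hint : Integrable (fun x => frobeniusNormSq (fderiv ℝ (curl φ) x)) := hc.integrable_of_hasCompactSupport hsupp
  have hiB : Integrable (Bp.indicator (wd w)) := iwd.indicator hBpm
  have hiL : Integrable (L.indicator (wd w)) := iwd.indicator hLm
  have hrhs : Integrable (fun x => Bp.indicator (wd w) x + L.indicator (wd w) x +
      6 * ‖fderiv ℝ (curl φ) x - χ x • fderiv ℝ (curl w) x‖ ^ 2) := (hiB.add hiL).add (hi2.const_mul 6)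
  have hmono := integral_mono hint hrhs hpt
  have hsplit : ∫ x, (Bp.indicator (wd w) x + L.indicator (wd w) x + 6 * ‖fderiv ℝ (curl φ) x - χ x • fderiv ℝ (curl w) x‖ ^ 2) =
      (∫ x, Bp.indicator (wd w) x) + (∫ x, L.indicator (wd w) x) +
        6 * ∫ x, ‖fderiv ℝ (curl φ) x - χ x • fderiv ℝ (curl w) x‖ ^ 2 := by
    rw [integral_add (f := fun x => Bp.indicator (wd w) x + L.indicator (wd w) x)
      (g := fun x => 6 * ‖fderiv ℝ (curl φ) x - χ x • fderiv ℝ (curl w) x‖ ^ 2) (hiB.add hiL) (hi2.const_mul 6),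
      integral_add hiB hiL, integral_const_mul]
  have hB' : ∫ x, Bp.indicator (wd w) x = (∫ x in Bp, wd w x) := by rw [integral_indicator hBpm]
  have hL' : ∫ x, L.indicator (wd w) x = (∫ x in Bp, wd w x) - (∫ x in B, wd w x) := by
    rw [integral_indicator hLm, hL, setIntegral_sdiff hBm iwd.integrableOn hsubB]
  unfold Wpa
  linarith only [hmono, hsplit, hB', hL', hj₂]

/-- **`J(φ) ≥ J_B − 2A₁Z_L − 2A₁j₁ − m₃Z(φ)`** (set version). [folklore] -/
theorem Jst_piece_ge_set (hw : ContDiff ℝ (⊤ : ℕ∞) w) (hDw : ∀ x, ‖fderiv ℝ w x‖ ≤ A₁)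
    (h1 : ∫⁻ x, ‖iteratedFDeriv ℝ 1 w x‖ₑ ^ 2 < ⊤)
    (hφ : ContDiff ℝ (⊤ : ℕ∞) φ) (hφc : HasCompactSupport φ) (hBm : MeasurableSet B) (hBpm' : MeasurableSet Bp) (hsubB : B ⊆ Bp)
    (hχc : Continuous χ) (hχ01 : ∀ x, 0 ≤ χ x ∧ χ x ≤ 1) (hone : ∀ x ∈ B, χ x = 1)
    (hχout : ∀ x, x ∉ Bp → χ x = 0)
    (he1 : ∀ x, x ∉ Bp \ B → curl φ x - χ x • curl w x = 0)
    (hi1 : Integrable fun x => ‖curl φ x - χ x • curl w x‖ ^ 2) (hj₁ : ∫ x, ‖curl φ x - χ x • curl w x‖ ^ 2 ≤ j₁)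
    (he3 : ∀ x, ‖fderiv ℝ φ x - χ x • fderiv ℝ w x‖ ≤ m₃) :
    (∫ x in B, sd w x) - 2 * A₁ * ((∫ x in Bp, zd w x) - (∫ x in B, zd w x)) - 2 * A₁ * j₁ - m₃ * Zen φ ≤ Jst φ := by
  have hA₁ : 0 ≤ A₁ := (norm_nonneg _).trans (hDw 0)
  have hw2 : ContDiff ℝ 2 w := hw.of_le (by norm_cast)
  have izd : Integrable (zd w) := (integrable_norm_curl_sq hw2 h1).1
  have isd : Integrable (sd w) := KStar.integrable_stretching hw hDw h1
  set L : Set E3 := Bp \ B with hL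
  have hLm : MeasurableSet L := hBpm'.diff hBm
  have hzd0 : ∀ y, 0 ≤ zd w y := fun y => sq_nonneg _
  -- pointwise lower bound for the stretching density of the piece
  have hpt : ∀ x, χ x ^ 3 * sd w x - (A₁ * L.indicator (zd w) x + 2 * A₁ * ‖curl φ x - χ x • curl w x‖ ^ 2) -
      m₃ * ‖curl φ x‖ ^ 2 ≤ sd φ x := by
    intro x
    have hmain := inner_piece_pointwise (u := curl φ x) (wv := curl w x) (e₁ := curl φ x - χ x • curl w x)
      (A := fderiv ℝ φ x) (D := fderiv ℝ w x) (E₃ := fderiv ℝ φ x - χ x • fderiv ℝ w x)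
      (by abel) (by abel) (hχ01 x).1 (hχ01 x).2 (hDw x) (he3 x)
    have hsdφ : sd φ x = ⟪curl φ x, fderiv ℝ φ x (curl φ x)⟫ := rfl
    have hsdw : sd w x = ⟪curl w x, fderiv ℝ w x (curl w x)⟫ := rfl
    rw [hsdφ, hsdw]
    by_cases hx : x ∈ L
    · rw [indicator_of_mem hx]
      have hzd : zd w x = ‖curl w x‖ ^ 2 := rfl
      rw [hzd]
      nlinarith only [hmain, sq_nonneg (‖curl w x‖ - ‖curl φ x - χ x • curl w x‖), hA₁]
    · rw [indicator_of_notMem hx, he1 x hx, norm_zero]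
      rw [he1 x hx, norm_zero] at hmain
      linarith only [hmain]
  -- integrability
  have hφ1 : ContDiff ℝ 1 φ := hφ.of_le (by norm_cast)
  have cφ : Continuous (curl φ) := continuous_curl hφ1
  have isdφ : Integrable (sd φ) := by
    have hc : Continuous (sd φ) := cφ.inner ((hφ.continuous_fderiv (by simp)).clm_apply cφ)
    refine hc.integrable_of_hasCompactSupport (HasCompactSupport.intro (hasCompactSupport_curl hφc) fun x hx => ?_)
    show ⟪curl φ x, fderiv ℝ φ x (curl φ x)⟫ = 0
    rw [image_eq_zero_of_notMem_tsupport hx, inner_zero_left]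
  have hci : Continuous (fun x => ‖curl φ x‖ ^ 2) := cφ.norm.pow 2
  have izφ : Integrable (fun x => ‖curl φ x‖ ^ 2) := by
    refine hci.integrable_of_hasCompactSupport (HasCompactSupport.intro (hasCompactSupport_curl hφc) fun x hx => ?_)
    rw [image_eq_zero_of_notMem_tsupport hx, norm_zero, zero_pow two_ne_zero]
  have iχsd : Integrable (fun x => χ x ^ 3 * sd w x) := by
    refine isd.bdd_mul (c := 1) ((hχc.pow 3).aestronglyMeasurable) (ae_of_all _ fun x => ?_)
    rw [Real.norm_eq_abs, abs_of_nonneg (pow_nonneg (hχ01 x).1 3)]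
    exact pow_le_one₀ (hχ01 x).1 (hχ01 x).2
  have iL : Integrable (L.indicator (zd w)) := izd.indicator hLm
  have ilhs : Integrable (fun x => χ x ^ 3 * sd w x - (A₁ * L.indicator (zd w) x + 2 * A₁ * ‖curl φ x - χ x • curl w x‖ ^ 2) -
      m₃ * ‖curl φ x‖ ^ 2) := ((iχsd.sub ((iL.const_mul A₁).add (hi1.const_mul (2 * A₁)))).sub (izφ.const_mul m₃))
  have hmono := integral_mono ilhs isdφ hpt
  have hsplit : ∫ x, (χ x ^ 3 * sd w x - (A₁ * L.indicator (zd w) x + 2 * A₁ * ‖curl φ x - χ x • curl w x‖ ^ 2) -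
      m₃ * ‖curl φ x‖ ^ 2) = (∫ x, χ x ^ 3 * sd w x) - (A₁ * (∫ x, L.indicator (zd w) x) +
        2 * A₁ * ∫ x, ‖curl φ x - χ x • curl w x‖ ^ 2) - m₃ * ∫ x, ‖curl φ x‖ ^ 2 := by
    rw [integral_sub (f := fun x => χ x ^ 3 * sd w x - (A₁ * L.indicator (zd w) x + 2 * A₁ * ‖curl φ x - χ x • curl w x‖ ^ 2))
      (g := fun x => m₃ * ‖curl φ x‖ ^ 2) (iχsd.sub ((iL.const_mul A₁).add (hi1.const_mul (2 * A₁)))) (izφ.const_mul m₃),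
      integral_sub (f := fun x => χ x ^ 3 * sd w x) (g := fun x => A₁ * L.indicator (zd w) x + 2 * A₁ * ‖curl φ x - χ x • curl w x‖ ^ 2)
      iχsd ((iL.const_mul A₁).add (hi1.const_mul (2 * A₁))),
      integral_add (f := fun x => A₁ * L.indicator (zd w) x) (g := fun x => 2 * A₁ * ‖curl φ x - χ x • curl w x‖ ^ 2)
      (iL.const_mul A₁) (hi1.const_mul (2 * A₁)),
      integral_const_mul, integral_const_mul, integral_const_mul]
  have hL' : ∫ x, L.indicator (zd w) x = (∫ x in Bp, zd w x) - (∫ x in B, zd w x) := by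
    rw [integral_indicator hLm, hL, setIntegral_sdiff hBm izd.integrableOn hsubB]
  -- `∫ χ³ sd ≥ J_B − A₁ Z_L`
  have hχ3 : (∫ x in B, sd w x) - A₁ * ((∫ x in Bp, zd w x) - (∫ x in B, zd w x)) ≤ ∫ x, χ x ^ 3 * sd w x := by
    have iB : Integrable ((B).indicator (sd w)) := isd.indicator hBm
    have hpt2 : ∀ x, (B).indicator (sd w) x - A₁ * L.indicator (zd w) x ≤ χ x ^ 3 * sd w x := by
      intro x
      have hsdle : |sd w x| ≤ A₁ * zd w x :=
        (abs_sd_le w x).trans (mul_le_mul_of_nonneg_right (hDw x) (hzd0 x))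
      by_cases hxB : x ∈ B
      · have hxL : x ∉ L := fun h => h.2 hxB
        rw [indicator_of_mem hxB, indicator_of_notMem hxL, hone x hxB]
        simp
      · rw [indicator_of_notMem hxB]
        by_cases hxBp : x ∈ Bp
        · have hxL : x ∈ L := ⟨hxBp, hxB⟩
          rw [indicator_of_mem hxL]
          have hχ3le : χ x ^ 3 ≤ 1 := pow_le_one₀ (hχ01 x).1 (hχ01 x).2
          have hχ30 : 0 ≤ χ x ^ 3 := pow_nonneg (hχ01 x).1 3
          have hlow := (abs_le.1 hsdle).1
          have hup := (abs_le.1 hsdle).2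
          nlinarith only [hlow, hup, hχ3le, hχ30, mul_nonneg hA₁ (hzd0 x)]
        · have hxL : x ∉ L := fun h => hxBp h.1
          rw [indicator_of_notMem hxL, hχout x hxBp]
          simp
    have ilhs2 : Integrable (fun x => (B).indicator (sd w) x - A₁ * L.indicator (zd w) x) := iB.sub (iL.const_mul A₁)
    have hmono2 := integral_mono ilhs2 iχsd hpt2
    rw [integral_sub (f := fun x => (B).indicator (sd w) x) (g := fun x => A₁ * L.indicator (zd w) x) iB (iL.const_mul A₁),
      integral_const_mul, integral_indicator hBm, hL'] at hmono2
    exact hmono2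
  have hAj : 2 * A₁ * (∫ x, ‖curl φ x - χ x • curl w x‖ ^ 2) ≤ 2 * A₁ * j₁ := mul_le_mul_of_nonneg_left hj₁ (by positivity)
  unfold Jst Zen
  have hsdφ : (fun x => sd φ x) = fun x => ⟪curl φ x, fderiv ℝ φ x (curl φ x)⟫ := rfl
  rw [← hsdφ] at *
  rw [hL'] at hsplit
  linarith only [hmono, hsplit, hχ3, hAj]

end PieceSet

end Summit.NavierStokesRegularity.NavierStokesRegularity.Theorems.NearExtremalTransiencePerFlow.TwoThirds

end
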